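import Summits.ValiantsHypothesis.ValiantsHypothesis.Theorems.SymPencilEquivariantSdcNotQPYoungDegreeBound
import Literature.NumberTheory.DiophantineGeometry.StandardTableauxDichotomy
import HarnessLib

/-!
# ValiantsHypothesis — the equivariant dial: THRESHOLD PERMIFY, file 3/5 — the THRESHOLD YOUNG
# DICHOTOMY and Young fixed vectors (H2) at an arbitrary index budget

Helper of `stmt-ValiantsHypothesis-23702` (`--as helper`; 0 definitions, 0 named facts, closes NO
item).  Decomposition workshop VALIANT, lens-1, g36, offer O-L1-28 «THRESHOLD PERMIFY».

The new input of O-L1-28.  The tree's permify chain pays `2^{(log₂ k + log₂ n + c)^c}` for the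
index of a Young fixed-vector subgroup because its Young-tableaux inequality (YD,
`youngDegreeBound_holds`) bounds the index of `R_ν` by a QUASI-POLYNOMIAL function of `f^λ`.  Here the
inequality is replaced by a THRESHOLD DICHOTOMY with a free parameter `τ`:

* **`young_threshold`**: for every `λ ⊢ n` and every `τ`, EITHER `λ` or `λᵀ` has Young subgroup of
  index `≤ (n+1)^τ` (the first row resp. column leaves `< τ` boxes: `[𝔖_n : R_ν] ≤ n!/ν₁! ≤ n^{n-ν₁}`),
  OR `f^λ ≥ 2^{⌊τ/2⌋}` — the Specht-dimension dichotomy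
  `Literature.NumberTheory.DiophantineGeometry.spechtDimDichotomy` (PROVED Literature fact, James–Kerber
  2.4; a crude effective form of Rasala's minimal-degree theorem), used on Valiant's problem for the
  first time;
* **`youngFixedVector_of_budget`**: (H2) at budget `B` — if every `λ ⊢ n` with `f^λ ≤ 2k` has
  `ν ∈ {λ, λᵀ}` with `[𝔖_n : R_ν] ≤ B`, then every `σ : 𝔄_n × 𝔄_n →* GL_k ℂ`, `k ≥ 1`, has a nonzero
  functional fixed by a subgroup of index `≤ B·B` (transcription of the tree's
  `youngFixedVector_of_degreeBound`: `alternating_fixed_vector` on each factor, contragredient);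
* **`youngFixedVector_threshold`**: hence for every `τ`: `2^{⌊τ/2⌋} ≤ 2k` OR a fixed functional under
  a subgroup of index `≤ (n+1)^τ (n+1)^τ`.

So an irreducible block of dimension `k` is permified at POLYNOMIAL cost `(n+1)^{2τ}` as soon as
`τ > 2 log₂ (2k) + 1`; files 4/5 turn this into the diagonal rate `2^{Ω(n / log n)}` i.o. and the
hardness of all polylog heads `(log₂ m)^E`, `E ≥ 2`.

HONEST BOUNDARY: 0 S-currency; closes NO item; infrastructure (no dial claim in this file);
`youngFixedVector_of_budget` is a TRANSCRIPTION of a tree proof; `stmt-23702` / `VP ≠ VNP` untouched.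
-/

noncomputable section

set_option linter.dupNamespace false

namespace Summit.ValiantsHypothesis.ValiantsHypothesis.Theorems.EquivariantDialThresholdPermify

open Matrix Literature.NumberTheory.DiophantineGeometry
open Summit.ValiantsHypothesis.ValiantsHypothesis.Theorems.SymPencilEquivariantSdcNotQP.YoungBounds

/-! ## The threshold dichotomy -/

/-- A first row leaving fewer than `τ` boxes gives a Young subgroup of index `≤ (n+1)^τ`:
`[𝔖_n : R_μ] · μ₁! ≤ n!` (`index_rowStabilizer_mul_factorial_le`), `n!/μ₁! = n^{\underline{n-μ₁}} ≤ n^{n-μ₁}`.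
[folklore] -/
theorem index_rowStabilizer_le_pow_of_lt {n τ : ℕ} (μ : Nat.Partition n)
    (h : n < μ.parts.sup + τ) : (rowStabilizer μ).index ≤ (n + 1) ^ τ := by
  classical
  rcases Nat.eq_zero_or_pos n with hn0 | hn
  · subst hn0
    have h1 : (rowStabilizer μ).index ∣ 1 := by
      have := (rowStabilizer μ).index_dvd_card
      rwa [Nat.card_perm, Nat.card_eq_fintype_card, Fintype.card_fin, Nat.factorial_zero] at this
    rw [Nat.dvd_one.mp h1]
    exact Nat.one_le_pow _ _ (Nat.succ_pos _)
  obtain ⟨ν₀, hs⟩ := exists_sortedParts_eq_sup_cons μ (by omega)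
  set a := μ.parts.sup with ha
  have han : a + (n - a) = n := add_eq_of_sortedParts_eq_cons hs
  have hle : a ≤ n := by omega
  have h1 := index_rowStabilizer_mul_factorial_le μ hs
  have h2 : (n - (n - a)).factorial * n.descFactorial (n - a) = n.factorial :=
    Nat.factorial_mul_descFactorial (Nat.sub_le n a)
  rw [Nat.sub_sub_self hle] at h2
  have h1' : a.factorial * (rowStabilizer μ).index ≤ a.factorial * n.descFactorial (n - a) :=
    calc a.factorial * (rowStabilizer μ).index = (rowStabilizer μ).index * a.factorial := mul_comm _ _
      _ ≤ n.factorial := h1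
      _ = a.factorial * n.descFactorial (n - a) := h2.symm
  calc (rowStabilizer μ).index ≤ n.descFactorial (n - a) :=
        Nat.le_of_mul_le_mul_left h1' (Nat.factorial_pos a)
    _ ≤ n ^ (n - a) := Nat.descFactorial_le_pow n (n - a)
    _ ≤ (n + 1) ^ (n - a) := Nat.pow_le_pow_left (Nat.le_succ n) _
    _ ≤ (n + 1) ^ τ := Nat.pow_le_pow_right (Nat.succ_pos n) (by omega)

/-- **THE THRESHOLD YOUNG DICHOTOMY.**  For every `λ ⊢ n` and every threshold `τ`: a row or column
side of `λ` has Young subgroup of index `≤ (n+1)^τ`, or `f^λ ≥ 2^{⌊τ/2⌋}`.  If both `λ₁ + τ ≤ n` and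
`λ'₁ + τ ≤ n` this is `spechtDimDichotomy n τ λ`; otherwise `index_rowStabilizer_le_pow_of_lt` for the
side with fewer than `τ` boxes outside its first line.
[cite: JamesKerber1981, 2.4.3/2.4.10 via `Literature.NumberTheory.DiophantineGeometry.spechtDimDichotomy`;
Rasala 1977 (J. Algebra 45) for the sharp minimal-degree classification] -/
theorem young_threshold (n τ : ℕ) (lam : Nat.Partition n) :
    (∃ ν : Nat.Partition n, (ν = lam ∨ ν = lam.transpose) ∧
      (rowStabilizer ν).index ≤ (n + 1) ^ τ) ∨ 2 ^ (τ / 2) ≤ numStandardTableaux lam := by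
  by_cases h1 : lam.parts.sup + τ ≤ n
  · by_cases h2 : lam.transpose.parts.sup + τ ≤ n
    · exact Or.inr (spechtDimDichotomy n τ lam h1 h2)
    · exact Or.inl ⟨lam.transpose, Or.inr rfl,
        index_rowStabilizer_le_pow_of_lt lam.transpose (by omega)⟩
  · exact Or.inl ⟨lam, Or.inl rfl, index_rowStabilizer_le_pow_of_lt lam (by omega)⟩

/-! ## (H2) at an arbitrary budget -/

/-- **(H2) at budget `B`** — transcription of the tree's `youngFixedVector_of_degreeBound` with the
index budget a hypothesis on the partitions `λ` with `f^λ ≤ 2k` only: `alternating_fixed_vector` for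
the first factor `𝔄_n` acting contragrediently on `ℂ^k` gives `λ₁` with `f^{λ₁} ≤ 2k` and, for the side
`ν₁ ∈ {λ₁, λ₁ᵀ}` supplied by `hYD`, a subgroup `Y₁` of index `≤ B` with a fixed vector; the second
factor acts on the `Y₁`-fixed subspace `W` (dimension `≤ k`): `Y₂` of index `≤ B` with a common fixed
`w ≠ 0`; `Y = Y₁ × Y₂`, `ℓ = ⟨w, ·⟩`. [folklore; transcription] -/
theorem youngFixedVector_of_budget (n k B : ℕ)
    (σ : ↥(alternatingGroup (Fin n)) × ↥(alternatingGroup (Fin n)) →* GL (Fin k) ℂ) (hk : 1 ≤ k)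
    (hYD : ∀ lam : Nat.Partition n, numStandardTableaux lam ≤ 2 * k →
      ∃ ν : Nat.Partition n, (ν = lam ∨ ν = lam.transpose) ∧ (rowStabilizer ν).index ≤ B) :
    ∃ Y : Subgroup (↥(alternatingGroup (Fin n)) × ↥(alternatingGroup (Fin n))),
      Y.index ≤ B * B ∧ ∃ ℓ : (Fin k → ℂ) →ₗ[ℂ] ℂ, ℓ ≠ 0 ∧
        ∀ y ∈ Y, ℓ ∘ₗ Matrix.toLin' (σ y : Matrix (Fin k) (Fin k) ℂ) = ℓ := by
  classical
  set G := ↥(alternatingGroup (Fin n)) with hG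
  -- the contragredient action on `ℂ^k`
  let ρ' : (G × G) →* ((Fin k → ℂ) →ₗ[ℂ] (Fin k → ℂ)) :=
    { toFun := fun g => Matrix.toLin' ((σ g⁻¹ : Matrix (Fin k) (Fin k) ℂ)ᵀ)
      map_one' := by
        rw [inv_one, map_one, Units.val_one, Matrix.transpose_one, Matrix.toLin'_one]
        rfl
      map_mul' := fun g h => by
        rw [_root_.mul_inv_rev, map_mul, Units.val_mul, Matrix.transpose_mul, Matrix.toLin'_mul]
        rfl }
  have hρ' : ∀ g, ρ' g = Matrix.toLin' ((σ g⁻¹ : Matrix (Fin k) (Fin k) ℂ)ᵀ) := fun g => rfl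
  haveI : Nonempty (Fin k) := ⟨⟨0, hk⟩⟩
  -- first factor
  let ρ₁ : Representation ℂ G (Fin k → ℂ) := ρ'.comp (MonoidHom.inl G G)
  have hρ₁ : ∀ a : G, ρ₁ a = ρ' (a, 1) := fun a => rfl
  obtain ⟨lam₁, hdim₁, hfix₁⟩ := alternating_fixed_vector n ρ₁
  rw [Module.finrank_fin_fun] at hdim₁
  obtain ⟨ν₁, hν₁, hidx₁⟩ := hYD lam₁ hdim₁
  obtain ⟨Y₁, hY₁, v, hv0, hv⟩ := hfix₁ ν₁ hν₁
  -- the subspace of `Y₁`-fixed vectors, invariant under the second factor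
  let W : Submodule ℂ (Fin k → ℂ) :=
    { carrier := {w | ∀ y ∈ Y₁, ρ₁ y w = w}
      zero_mem' := by intro y _; simp
      add_mem' := by
        intro a b ha hb y hy
        rw [map_add, ha y hy, hb y hy]
      smul_mem' := by
        intro r a ha y hy
        rw [map_smul, ha y hy] }
  have hW : ∀ w, w ∈ W ↔ ∀ y ∈ Y₁, ρ₁ y w = w := fun w => Iff.rfl
  have hcomm : ∀ (a b : G) (w : Fin k → ℂ), ρ' (a, 1) (ρ' (1, b) w) = ρ' (1, b) (ρ' (a, 1) w) := by
    intro a b w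
    rw [← Module.End.mul_apply, ← map_mul, ← Module.End.mul_apply, ← map_mul]
    have h : ((a, 1) : G × G) * (1, b) = (1, b) * (a, 1) := by ext <;> simp
    rw [h]
  have hWinv : ∀ (b : G), ∀ w ∈ W, ρ' (1, b) w ∈ W := by
    intro b w hw y hy
    rw [hρ₁, hcomm, ← hρ₁, hw y hy]
  let ρ₂ : Representation ℂ G W :=
    { toFun := fun b => (ρ' (1, b)).restrict (hWinv b)
      map_one' := by
        apply LinearMap.ext; intro w; apply Subtype.ext
        simp only [LinearMap.coe_restrict_apply, Module.End.one_apply]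
        rw [show ((1 : G), (1 : G)) = (1 : G × G) from rfl, map_one, Module.End.one_apply]
      map_mul' := fun a b => by
        apply LinearMap.ext; intro w; apply Subtype.ext
        simp only [LinearMap.coe_restrict_apply, Module.End.mul_apply]
        rw [← Module.End.mul_apply, ← map_mul]
        rfl }
  have hρ₂ : ∀ (b : G) (w : W), ((ρ₂ b w : W) : Fin k → ℂ) = ρ' (1, b) (w : Fin k → ℂ) :=
    fun b w => rfl
  haveI : Nontrivial W := ⟨⟨⟨v, (hW v).2 hv⟩, 0, fun h => hv0 (congrArg Subtype.val h)⟩⟩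
  obtain ⟨lam₂, hdim₂, hfix₂⟩ := alternating_fixed_vector n ρ₂
  have hdim₂' : numStandardTableaux lam₂ ≤ 2 * k := by
    have : Module.finrank ℂ W ≤ k := by
      calc Module.finrank ℂ W ≤ Module.finrank ℂ (Fin k → ℂ) := Submodule.finrank_le W
        _ = k := Module.finrank_fin_fun ℂ
    omega
  obtain ⟨ν₂, hν₂, hidx₂⟩ := hYD lam₂ hdim₂'
  obtain ⟨Y₂, hY₂, w, hw0, hw⟩ := hfix₂ ν₂ hν₂
  -- the subgroup and the functional
  refine ⟨Y₁.prod Y₂, ?_, ?_⟩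
  · rw [Subgroup.index_prod]
    exact Nat.mul_le_mul (hY₁.trans hidx₁) (hY₂.trans hidx₂)
  · set wv : Fin k → ℂ := (w : Fin k → ℂ) with hwv
    have hwv0 : wv ≠ 0 := fun h => hw0 (Subtype.ext h)
    -- `wv` is fixed by `ρ' y` for every `y ∈ Y₁ × Y₂`
    have hfixed : ∀ y ∈ Y₁.prod Y₂, ρ' y wv = wv := by
      rintro ⟨y₁, y₂⟩ hy
      rw [Subgroup.mem_prod] at hy
      obtain ⟨hy₁, hy₂⟩ := hy
      have h1 : ((y₁, y₂) : G × G) = (y₁, 1) * (1, y₂) := by ext <;> simp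
      have h2 : ρ' (1, y₂) wv = wv := by
        have := congrArg Subtype.val (hw y₂ hy₂)
        rwa [hρ₂] at this
      have h3 : ρ' (y₁, 1) wv = wv := by rw [← hρ₁]; exact (hW wv).1 w.2 y₁ hy₁
      rw [h1, map_mul, Module.End.mul_apply, h2, h3]
    -- the functional `x ↦ wv ⬝ᵥ x`
    let ℓ : (Fin k → ℂ) →ₗ[ℂ] ℂ :=
      { toFun := fun x => wv ⬝ᵥ x
        map_add' := fun x y => dotProduct_add wv x y
        map_smul' := fun r x => by rw [dotProduct_smul]; rfl }
    have hℓ : ∀ x, ℓ x = wv ⬝ᵥ x := fun x => rfl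
    refine ⟨ℓ, ?_, fun y hy => ?_⟩
    · intro h
      apply hwv0
      funext i
      have := congrArg (fun f : (Fin k → ℂ) →ₗ[ℂ] ℂ => f (Pi.single i 1)) h
      simp only [hℓ, dotProduct_single, mul_one, LinearMap.zero_apply] at this
      exact this
    · have hyinv : ρ' y⁻¹ wv = wv := hfixed y⁻¹ (inv_mem hy)
      rw [hρ', inv_inv, Matrix.toLin'_apply, Matrix.mulVec_transpose] at hyinv
      apply LinearMap.ext
      intro x
      rw [LinearMap.comp_apply, hℓ, hℓ, Matrix.toLin'_apply, Matrix.dotProduct_mulVec, hyinv]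

/-- **(H2) at the threshold budget.**  For every `τ`: either `2^{⌊τ/2⌋} ≤ 2k`, or every
`σ : 𝔄_n × 𝔄_n →* GL_k ℂ`, `k ≥ 1`, has a nonzero functional fixed by a subgroup of index
`≤ (n+1)^τ (n+1)^τ` (`youngFixedVector_of_budget` fed by `young_threshold`, whose second branch
`2^{⌊τ/2⌋} ≤ f^λ ≤ 2k` is excluded). [folklore] -/
theorem youngFixedVector_threshold (n τ k : ℕ)
    (σ : ↥(alternatingGroup (Fin n)) × ↥(alternatingGroup (Fin n)) →* GL (Fin k) ℂ) (hk : 1 ≤ k) :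
    2 ^ (τ / 2) ≤ 2 * k ∨
      ∃ Y : Subgroup (↥(alternatingGroup (Fin n)) × ↥(alternatingGroup (Fin n))),
        Y.index ≤ (n + 1) ^ τ * (n + 1) ^ τ ∧ ∃ ℓ : (Fin k → ℂ) →ₗ[ℂ] ℂ, ℓ ≠ 0 ∧
          ∀ y ∈ Y, ℓ ∘ₗ Matrix.toLin' (σ y : Matrix (Fin k) (Fin k) ℂ) = ℓ := by
  by_cases h : 2 ^ (τ / 2) ≤ 2 * k
  · exact Or.inl h
  · refine Or.inr (youngFixedVector_of_budget n k ((n + 1) ^ τ) σ hk fun lam hf => ?_)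
    rcases young_threshold n τ lam with h' | h'
    · exact h'
    · exact absurd (h'.trans hf) h

end Summit.ValiantsHypothesis.ValiantsHypothesis.Theorems.EquivariantDialThresholdPermify

end
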